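import HarnessLib
import Literature.NumberTheory.GelbartRogawski1991.Sec2
import Literature.NumberTheory.GelbartRogawski1991.Sec3Theta

/-!
# Gelbart–Rogawski 1991, §3.4 — the three logical links between the typed statements of
# `Sec3Theta.lean`, `Sec2.lean` and the ★ dictionary `GR91Spectrum` (kernel-checked, no new statement)

Sibling PROOF file of the squad-TG carpet `Sec3Theta.lean` ([GelbartRogawski1991] §3.3–§3.4,
pp. 458–462).  The carpets are statements only (squad rule); the two-line consequences «K» announced
in their docstrings are proved HERE, with conclusions typed literally as the tree's names.  No
definition, no new named fact, no restated statement.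

* `thm34a_iff_eq342` — ★ `GR91Spectrum.thm34a` (Theorem 3.4 (a), p. 461) is literally
  «(3.4.2) ⟹ `ω(γ, ψ, χ) ∈ Π(ρ)`» with (3.4.2) = `Sec3Theta.eq342`.
* `sameOrbit_tau_iff` — the printed REDUCTION inside the Remark after Theorem 3.4 (p. 461: «and so we
  need only show that `ω(γ, ψ, χ) = ω(γ′, ψ′, χ′)` if and only if `γ′ = γ`, `χ′ = χ`, and `ψ′ = ψ^δ`
  for some `δ ∈ N_{E/F}(E*)`»): from `remark461_bijection` (the bijection), `weilOfR_tau`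
  (`ω(τ(γ,ψ,χ)) = ω(γ,ψ,χ)`), `tau_mem` and ★ `weil_eq_iff`, two parametrised elements `τ(γ,ψ,χ)`,
  `τ(γ′,ψ′,χ′)` lie in one `B(F)`-orbit iff `γ′ = γ ∧ χ′ = χ ∧ ψ′ = ψ^δ`.
* `remark461_orbit_of` — «`τ^δ = τ(γ, ψ^δ, χ)`» (`Sec3Theta.remark461_orbit`) FOLLOWS from the same
  four together with `tau_surjective` and §2.3's `B(F)`-action `Sec2.bAct_rhat` (p. 452 ¶1): the
  §2 and §3 carpets cohere.
* `rhat_exists_psi_of` (edition 2) — §2's P-IMPLICIT head `Sec2.rhat_exists_psi` («every element of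
  `R^∧` lies in some `R^∧(ψ)`», p. 451) FOLLOWS from the §3.4 parametrisation: every `τ ∈ R^∧` is a
  `τ(γ, ψ, χ)` (`tau_surjective`, p. 460 L35–36) and `τ(γ, ψ, χ) ∈ R^∧(ψ)` (`tau_mem`); it discharges the
  hypothesis `(h : rhat_exists_psi J)` of `Sec2Proofs.rhat_eq_iUnion_rhatPsi` / `existsUnique_rhatPsi`.

## References
* [GelbartRogawski1991] Thm. 3.4 (a) (3.4.2) p. 461; Remark after Thm. 3.4 pp. 461–462; §2.3 p. 452 ¶1.
* Tree: ★ `GR91Spectrum.thm34a`, `GR91Spectrum.weil_eq_iff` (`WeilRepresentationsAPackets.lean`);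
  `Sec2Defs.GR91RData`, `Sec2.bAct_rhat`; `Sec3ThetaDefs.GR91ThetaData`; `Sec3Theta.*`.
-/

namespace Literature.NumberTheory.GelbartRogawski1991.Sec3ThetaProofs

open Sec2Defs Sec3ThetaDefs Sec3Theta

universe u

variable {X : GR91Spectrum.{u}} {GA : Type u} [Group GA] {J : GR91RData X GA} (D : GR91ThetaData X J)

/-- **K.** ★ Theorem 3.4 (a) as typed (`GR91Spectrum.thm34a`) is «(3.4.2) ⟹ `ω(γ, ψ, χ) ∈ Π(ρ)`», with
(3.4.2) the named relation `Sec3Theta.eq342`. [cite: GelbartRogawski1991, Thm. 3.4 (a) (3.4.2) (p. 461)] -/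
theorem thm34a_iff_eq342 (X : GR91Spectrum.{u}) :
    X.thm34a ↔ ∀ (γ : X.OmegaHecke) (ψ : X.AddChar) (χ η η' : X.Char1),
      eq342 X γ χ η η' → X.weil γ ψ χ ∈ X.packetA η η' := by
  simp only [GR91Spectrum.thm34a, eq342, and_imp]

/-- **K — the Remark's reduction** (p. 461: «we need only show that `ω(γ, ψ, χ) = ω(γ′, ψ′, χ′)` if and
only if `γ′ = γ`, `χ′ = χ`, and `ψ′ = ψ^δ` for some `δ ∈ N_{E/F}(E*)`»): given the bijection
`B(F)\R^∧ ≅ Ω` (`remark461_bijection`), `ω(τ(γ,ψ,χ)) = ω(γ,ψ,χ)` (`weilOfR_tau`), `τ(γ,ψ,χ) ∈ R^∧(ψ)`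
(`tau_mem`) and ★ `weil_eq_iff`, the parametrised elements `τ(γ, ψ, χ)`, `τ(γ′, ψ′, χ′)` lie in one
`B(F)`-orbit iff `γ′ = γ ∧ χ′ = χ ∧ ψ′ = ψ^δ` (`X.NormClassEq ψ ψ′`).
[cite: GelbartRogawski1991, §3.4 Remark after Thm. 3.4 (pp. 461–462)] -/
theorem sameOrbit_tau_iff (hbij : remark461_bijection D) (hωτ : weilOfR_tau D) (hmem : tau_mem D)
    (heq : X.weil_eq_iff) (γ γ' : X.OmegaHecke) (ψ ψ' : X.AddChar) (χ χ' : X.Char1) :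
    J.SameOrbit (D.tau γ ψ χ) (D.tau γ' ψ' χ') ↔ γ' = γ ∧ χ' = χ ∧ X.NormClassEq ψ ψ' := by
  rw [hbij _ (hmem γ ψ χ).1 _ (hmem γ' ψ' χ').1, hωτ, hωτ]
  exact heq γ γ' ψ ψ' χ χ'

/-- **K — coherence of the §2 and §3 carpets**: «`τ^δ = τ(γ, ψ^δ, χ)`» (`Sec3Theta.remark461_orbit`: the
`B(F)`-orbit of `τ(γ, ψ, χ)` is `{τ(γ, ψ′, χ) : ψ′ = ψ^δ, δ ∈ N_{E/F}(E*)}`) follows from the bijection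
(`remark461_bijection`), `weilOfR_tau`, `tau_mem`, `tau_surjective`, ★ `weil_eq_iff` and the §2.3
statement «`b` maps `R^∧(ψ)` to `R^∧(ψ^{Nα})`» (`Sec2.bAct_rhat`, p. 452 ¶1).
[cite: GelbartRogawski1991, §3.4 Remark after Thm. 3.4 (pp. 461–462); §2.3 (p. 452 ¶1)] -/
theorem remark461_orbit_of (hbij : remark461_bijection D) (hωτ : weilOfR_tau D) (hmem : tau_mem D)
    (hsurj : tau_surjective D) (heq : X.weil_eq_iff) (hb : Sec2.bAct_rhat J) :
    remark461_orbit D := by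
  intro γ ψ χ τ'
  constructor
  · rintro ⟨b, rfl⟩
    obtain ⟨ψ₁, -, hmem₁⟩ := hb b ψ (D.tau γ ψ χ) (hmem γ ψ χ)
    obtain ⟨γ'', ψ'', χ'', hτ⟩ := hsurj _ hmem₁.1
    have h := (sameOrbit_tau_iff D hbij hωτ hmem heq γ γ'' ψ ψ'' χ χ'').1 (hτ ▸ ⟨b, rfl⟩)
    obtain ⟨rfl, rfl, hψ⟩ := h
    exact ⟨ψ'', hψ, hτ⟩
  · rintro ⟨ψ', hψ, rfl⟩
    exact (sameOrbit_tau_iff D hbij hωτ hmem heq γ γ ψ ψ' χ χ).2 ⟨rfl, rfl, hψ⟩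

/-- **K (edition 2) — every element of `R^∧` lies in some `R^∧(ψ)`.**  The §2 carpet records this as the
P-IMPLICIT head `Sec2.rhat_exists_psi` (how «(2.1.2) reads (2.3.1)», §2.3 p. 451); it FOLLOWS from the
§3.4 parametrisation of `R^∧`: «as we vary `(s′, ψ, χ)` we obtain all elements of `R^∧`» (`tau_surjective`,
p. 460 L35–36, p. 461 L1–3) and `τ(γ, ψ, χ) ∈ R^∧(ψ)` (`tau_mem`, p. 460 L21–35).  Discharges the hypothesis
`(h : rhat_exists_psi J)` of `Sec2Proofs.rhat_eq_iUnion_rhatPsi` / `Sec2Proofs.existsUnique_rhatPsi` for a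
consumer holding the §3.4 facts.  No new statement.
[cite: GelbartRogawski1991, §3.4 (p. 460 L21–36, p. 461 L1–3); §2.2–§2.3 (p. 451)] -/
theorem rhat_exists_psi_of (hs : tau_surjective D) (hm : tau_mem D) : Sec2.rhat_exists_psi J := by
  intro τ hτ
  obtain ⟨γ, ψ, χ, rfl⟩ := hs τ hτ
  exact ⟨ψ, (hm γ ψ χ).2⟩

end Literature.NumberTheory.GelbartRogawski1991.Sec3ThetaProofs
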